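import Summits.AtomisticToContinuum.HydrodynamicLimit.Theses.StiffCollisionalRelaxation
import Summits.AtomisticToContinuum.HydrodynamicLimit.Theses.SuperextensiveClosureCost
import Summits.AtomisticToContinuum.HydrodynamicLimit.Theses.LimitCollisionMeasure

/-!
# Crux-ideate sketch (round 1, ideator 1) for `FastMomentRelaxation` (stmt-AtomisticToContinuum-9522)

First lemmas of the two idea cards, typed over existing declarations only (no new Literature
notions). Card 1 `subviscous-window-transfer`: `SubViscousEqSuperExp` (the equilibrium, speed-capped,
sub-viscous super-exponential space–time large deviation), `FastMomentRelaxationSubViscous` (the crux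
at block exponents `1/6 < γ ≤ 1/4`), `MaxSpeedBoundAllTimes` (the a-priori cap, HighMomentumCutoff
class), `WindowReduction` (stationarity + pigeonhole, provable now), `NoMesoCascadeL2` (the collision-free
lift residual), and the two glue implications `TransferGlue`, `LiftGlue`. Card 2
`blind-contact-balance-dock`: `WeightedBalanceRigidity` (Boltzmann's uniqueness of collision
equilibria, measure version, for a collision-symmetric weight) and the typed transfer `BlindContactDock`
through the items of route LimitCollisionMeasure.
-/

noncomputable section

open MeasureTheory Filter Set Topology
open scoped BigOperators ENNReal Topology InnerProductSpace

namespace Summit.AtomisticToContinuum.HydrodynamicLimit.Cruxes.FastMomentRelaxation.IdeatorOne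

/-! ## Card 1 — sub-viscous equilibrium pricing + window reduction + Germano lift -/

/-- **C⁺ (equilibrium half).** Under the INVARIANT homogeneous hard-sphere Gibbs law
`G_N = localGibbsLaw σ 1 0 θe` (stationary, reversible, velocities i.i.d. Maxwellian ⊗ Gibbs
positions), for SUB-VISCOUS block exponents `1/6 < γ ≤ 1/4` (block radius `(N+1)^{-γ}` below the
viscous length `√(ν t) ≍ N^{-1/6}`) the crux's space–time functional exceeds `δ` WHILE every speed stays
`≤ (N+1)^{1/8}` on `[0,t]` only with SUPER-EXPONENTIALLY small probability: `≤ exp(−M(N+1))`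
eventually, for every `M` (the Newton-cradle floor ≈ (4/3)N log N forbids any better typed rate). -/
def SubViscousEqSuperExp : Prop :=
  ∃ σ₀ : ℝ, 0 < σ₀ ∧ ∀ σ : ℝ, 0 < σ → σ < σ₀ → ∀ θe : ℝ, 0 < θe → ∀ Φ : (N : ℕ) → Literature.Analysis.FluidPDE.HardSphereFlow (Literature.Analysis.FluidPDE.Torus.geometry (Fin 3)) (Literature.MathematicalPhysics.KineticTheory.hsDiameter σ N) (N + 1), ∀ (γ C : ℝ) (φ : ℕ → (UnitAddTorus (Fin 3)) → ℝ), 1 / 6 < γ → γ ≤ 1 / 4 → ((∀ N, Literature.Analysis.FunctionSpaces.Torus.IsSmooth (φ N)) ∧ (∀ N y, 0 ≤ φ N y) ∧ (∀ N, ∫ y, φ N y = 1) ∧ (∀ (N : ℕ) y, ((N : ℝ) + 1) ^ (-γ) ≤ Literature.Analysis.FluidPDE.Torus.euclidDist y 0 → φ N y = 0) ∧ (∀ (N : ℕ) y, φ N y ≤ C * ((N : ℝ) + 1) ^ (3 * γ)) ∧ (∀ (N : ℕ) y, ‖Literature.Analysis.FunctionSpaces.Torus.gradient (φ N) y‖ ≤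 C * ((N : ℝ) + 1) ^ (4 * γ))) → let ρb := fun (N : ℕ) (z : Literature.Analysis.FluidPDE.Config (N + 1) (Fin 3) (UnitAddTorus (Fin 3))) (x : (UnitAddTorus (Fin 3))) => Literature.MathematicalPhysics.KineticTheory.empiricalDensityField z (fun y => φ N (y - x)); let mb := fun (N : ℕ) (z : Literature.Analysis.FluidPDE.Config (N + 1) (Fin 3) (UnitAddTorus (Fin 3))) (x : (UnitAddTorus (Fin 3))) => Literature.MathematicalPhysics.KineticTheory.empiricalMomentumField z (fun y => φ N (y - x)); let ub := fun (N : ℕ) (z : Literature.Analysis.FluidPDE.Config (N + 1) (Fin 3) (UnitAddTorus (Fin 3))) (x : (UnitAddTorus (Fin 3))) => (ρb N z x)⁻¹ • mb N z x; let D := fun (N : ℕ) (z : Literature.Analysis.FluidPDE.Config (N + 1) (Fin 3) (UnitAddTorus (Fin 3))) (x : (UnitAddTorus (Fin 3))) (j k : Fin 3) => (∫ y, φ N (y.1 - x) * ((y.2 j - ub N z x j) * (y.2 k - ub N z x k)) ∂(Literature.Analysis.FluidPDE.empiricalMeasure z)) - (if j = k then (∑ l : Fin 3, ∫ y, φ N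 (y.1 - x) * (y.2 l - ub N z x l) ^ 2 ∂(Literature.Analysis.FluidPDE.empiricalMeasure z)) / 3 else 0); let q := fun (N : ℕ) (z : Literature.Analysis.FluidPDE.Config (N + 1) (Fin 3) (UnitAddTorus (Fin 3))) (x : (UnitAddTorus (Fin 3))) => ∫ y, (φ N (y.1 - x) * ‖y.2 - ub N z x‖ ^ 2 / 2) • (y.2 - ub N z x) ∂(Literature.Analysis.FluidPDE.empiricalMeasure z); ∀ t : ℝ, 0 < t → ∀ δ : ℝ, 0 < δ → ∀ M : ℝ, ∀ᶠ N : ℕ in atTop, Literature.MathematicalPhysics.KineticTheory.localGibbsLaw σ (fun _ => 1) (fun _ => 0) (fun _ => θe) N (Φ N) ({z | δ < ∫ s in Icc 0 t, ∫ x, ((∑ j, ∑ k, D N ((Φ N).flow s z) x j k ^ 2) + ‖q N ((Φ N).flow s z) x‖ ^ 2)} ∩ {z | ∀ s ∈ Icc 0 t, ∀ i, ‖((Φ N).flow s z i).2‖ ≤ ((N : ℝ) + 1) ^ ((1 : ℝ) / 8)}) ≤ ENNReal.ofReal (Real.exp (-(M * ((N : ℝ) + 1))))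

/-- The crux verbatim at sub-viscous block exponents `1/6 < γ ≤ 1/4` (instead of `0 < γ ≤ 1/15`). -/
def FastMomentRelaxationSubViscous : Prop :=
  ∀ (a₀ θ₀ : (UnitAddTorus (Fin 3)) → ℝ) (u₀ : (UnitAddTorus (Fin 3)) → (EuclideanSpace ℝ (Fin 3))), Continuous a₀ → Continuous θ₀ → Continuous u₀ → (∀ x, 0 < a₀ x) → (∀ x, 0 < θ₀ x) → ∃ σ₀ : ℝ, 0 < σ₀ ∧ ∀ σ : ℝ, 0 < σ → σ < σ₀ → ∀ Φ : (N : ℕ) → Literature.Analysis.FluidPDE.HardSphereFlow (Literature.Analysis.FluidPDE.Torus.geometry (Fin 3)) (Literature.MathematicalPhysics.KineticTheory.hsDiameter σ N) (N + 1), ∀ (γ C : ℝ) (φ : ℕ → (UnitAddTorus (Fin 3)) → ℝ), 1 / 6 < γ → γ ≤ 1 / 4 → ((∀ N, Literature.Analysis.FunctionSpaces.Torus.IsSmooth (φ N)) ∧ (∀ N y, 0 ≤ φ N y) ∧ (∀ N, ∫ y, φ N y = 1) ∧ (∀ (N : ℕ) y, ((N : ℝ) + 1) ^ (-γ) ≤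 Literature.Analysis.FluidPDE.Torus.euclidDist y 0 → φ N y = 0) ∧ (∀ (N : ℕ) y, φ N y ≤ C * ((N : ℝ) + 1) ^ (3 * γ)) ∧ (∀ (N : ℕ) y, ‖Literature.Analysis.FunctionSpaces.Torus.gradient (φ N) y‖ ≤ C * ((N : ℝ) + 1) ^ (4 * γ))) → let ρb := fun (N : ℕ) (z : Literature.Analysis.FluidPDE.Config (N + 1) (Fin 3) (UnitAddTorus (Fin 3))) (x : (UnitAddTorus (Fin 3))) => Literature.MathematicalPhysics.KineticTheory.empiricalDensityField z (fun y => φ N (y - x)); let mb := fun (N : ℕ) (z : Literature.Analysis.FluidPDE.Config (N + 1) (Fin 3) (UnitAddTorus (Fin 3))) (x : (UnitAddTorus (Fin 3))) => Literature.MathematicalPhysics.KineticTheory.empiricalMomentumField z (fun y => φ N (y - x)); let ub := fun (N : ℕ) (z : Literature.Analysis.FluidPDE.Config (N + 1) (Fin 3) (UnitAddTorus (Fin 3))) (x : (UnitAddTorus (Fin 3))) => (ρb N z x)⁻¹ • mb N z x; let D := fun (N : ℕ) (z : Literature.Analysis.FluidPDE.Config (N + 1) (Fin 3) (UnitAddTorus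 (Fin 3))) (x : (UnitAddTorus (Fin 3))) (j k : Fin 3) => (∫ y, φ N (y.1 - x) * ((y.2 j - ub N z x j) * (y.2 k - ub N z x k)) ∂(Literature.Analysis.FluidPDE.empiricalMeasure z)) - (if j = k then (∑ l : Fin 3, ∫ y, φ N (y.1 - x) * (y.2 l - ub N z x l) ^ 2 ∂(Literature.Analysis.FluidPDE.empiricalMeasure z)) / 3 else 0); let q := fun (N : ℕ) (z : Literature.Analysis.FluidPDE.Config (N + 1) (Fin 3) (UnitAddTorus (Fin 3))) (x : (UnitAddTorus (Fin 3))) => ∫ y, (φ N (y.1 - x) * ‖y.2 - ub N z x‖ ^ 2 / 2) • (y.2 - ub N z x) ∂(Literature.Analysis.FluidPDE.empiricalMeasure z); ∀ t : ℝ, 0 < t → ∀ δ : ℝ, 0 < δ → Tendsto (fun N : ℕ => Literature.MathematicalPhysics.KineticTheory.localGibbsLaw σ a₀ u₀ θ₀ N (Φ N) {z | δ < ∫ s in Icc 0 t, ∫ x, ((∑ j, ∑ k, D N ((Φ N).flow s z) x j k ^ 2) + ‖q N ((Φ N).flow s z) x‖ ^ 2)}) atTop (𝓝 0)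

/-- **A-priori cap along the non-equilibrium law (HighMomentumCutoff class; ∀ t, like the crux).**
No particle is faster than `(N+1)^{1/8}` on `[0,t]`, with probability → 1. -/
def MaxSpeedBoundAllTimes : Prop :=
  ∀ (a₀ θ₀ : (UnitAddTorus (Fin 3)) → ℝ) (u₀ : (UnitAddTorus (Fin 3)) → (EuclideanSpace ℝ (Fin 3))), Continuous a₀ → Continuous θ₀ → Continuous u₀ → (∀ x, 0 < a₀ x) → (∀ x, 0 < θ₀ x) → ∃ σ₀ : ℝ, 0 < σ₀ ∧ ∀ σ : ℝ, 0 < σ → σ < σ₀ → ∀ Φ : (N : ℕ) → Literature.Analysis.FluidPDE.HardSphereFlow (Literature.Analysis.FluidPDE.Torus.geometry (Fin 3)) (Literature.MathematicalPhysics.KineticTheory.hsDiameter σ N) (N + 1), ∀ t : ℝ, 0 < t → Tendsto (fun N : ℕ => Literature.MathematicalPhysics.KineticTheory.localGibbsLaw σ a₀ u₀ θ₀ N (Φ N) {z | ∃ s ∈ Icc 0 t, ∃ i, ((N : ℝ) + 1) ^ ((1 : ℝ) / 8) < ‖((Φ N).flow s z i).2‖}) atTop (𝓝 0)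

/-- **Glue 1 (provable now from the PROVED support `TransferInequality`, stmt-9512):**
`LG(S)² ≤ e^{C(N+1)} G(S)` and `G(S ∩ cap) ≤ e^{−(C+1)(N+1)}` give `LG(S) ≤ LG(capᶜ) + e^{−(N+1)/2} → 0`. -/
def TransferGlue : Prop :=
  SubViscousEqSuperExp →
    Summit.AtomisticToContinuum.HydrodynamicLimit.Theses.SuperextensiveClosureCost.TransferInequality →
      MaxSpeedBoundAllTimes → FastMomentRelaxationSubViscous

/-- **Window reduction (stationarity + pigeonhole; provable now).** For a flow of measure-preserving maps
and a non-negative path functional, a time-integral exceeding `δ` on `[0,t]` forces one of `m` windows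
to exceed `δ/m`, and by invariance every window has the law of the first: the long-horizon equilibrium
estimate reduces to ONE window of length `t/m` (take `m = m_N → ∞` with `t ν_N / m_N → ∞`). -/
def WindowReduction : Prop :=
  ∀ (α : Type) [MeasurableSpace α] (μ : Measure α) (Φ : ℝ → α → α),
    (∀ s, MeasurePreserving (Φ s) μ μ) → (∀ s r, 0 ≤ s → 0 ≤ r → Φ (s + r) = Φ s ∘ Φ r) →
    ∀ F : α → ℝ, (∀ z, 0 ≤ F z) → Measurable (fun p : ℝ × α => F (Φ p.1 p.2)) →
    ∀ (t δ : ℝ), 0 < t → 0 < δ → ∀ m : ℕ, 0 < m →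
      μ {z | δ < ∫ s in Icc 0 t, F (Φ s z)} ≤
        m * μ {z | δ / m < ∫ s in Icc 0 (t / m), F (Φ s z)}

/-- **Lift residual (collision-free mesoscale compactness).** For a coarse admissible kernel family
(`0 < γ ≤ 1/15`, the crux's) and a fine sub-viscous one (`1/6 < γ' ≤ 1/4`): the subgrid kinetic energy
of the fine-filtered velocity inside the coarse blocks vanishes in the crux's `L²_{t,x}`-in-probability
sense (the Germano/Leonard stress of the two-filter split; no collision vocabulary). -/
def NoMesoCascadeL2 : Prop :=
  ∀ (a₀ θ₀ : (UnitAddTorus (Fin 3)) → ℝ) (u₀ : (UnitAddTorus (Fin 3)) → (EuclideanSpace ℝ (Fin 3))), Continuous a₀ → Continuous θ₀ → Continuous u₀ → (∀ x, 0 < a₀ x) → (∀ x, 0 < θ₀ x) → ∃ σ₀ : ℝ, 0 < σ₀ ∧ ∀ σ : ℝ, 0 < σ → σ < σ₀ → ∀ Φ : (N : ℕ) → Literature.Analysis.FluidPDE.HardSphereFlow (Literature.Analysis.FluidPDE.Torus.geometry (Fin 3)) (Literature.MathematicalPhysics.KineticTheory.hsDiameter σ N) (N + 1), ∀ (γ C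 : ℝ) (φ : ℕ → (UnitAddTorus (Fin 3)) → ℝ), 0 < γ → γ ≤ 1 / 15 → ((∀ N, Literature.Analysis.FunctionSpaces.Torus.IsSmooth (φ N)) ∧ (∀ N y, 0 ≤ φ N y) ∧ (∀ N, ∫ y, φ N y = 1) ∧ (∀ (N : ℕ) y, ((N : ℝ) + 1) ^ (-γ) ≤ Literature.Analysis.FluidPDE.Torus.euclidDist y 0 → φ N y = 0) ∧ (∀ (N : ℕ) y, φ N y ≤ C * ((N : ℝ) + 1) ^ (3 * γ)) ∧ (∀ (N : ℕ) y, ‖Literature.Analysis.FunctionSpaces.Torus.gradient (φ N) y‖ ≤ C * ((N : ℝ) + 1) ^ (4 * γ))) → ∀ (γ' C' : ℝ) (φ' : ℕ → (UnitAddTorus (Fin 3)) → ℝ), 1 / 6 < γ' → γ' ≤ 1 / 4 → ((∀ N, Literature.Analysis.FunctionSpaces.Torus.IsSmooth (φ' N)) ∧ (∀ N y, 0 ≤ φ' N y) ∧ (∀ N, ∫ y, φ' N y = 1) ∧ (∀ (N : ℕ) y, ((N : ℝ) + 1) ^ (-γ') ≤ Literature.Analysis.FluidPDE.Torus.euclidDist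 y 0 → φ' N y = 0) ∧ (∀ (N : ℕ) y, φ' N y ≤ C' * ((N : ℝ) + 1) ^ (3 * γ')) ∧ (∀ (N : ℕ) y, ‖Literature.Analysis.FunctionSpaces.Torus.gradient (φ' N) y‖ ≤ C' * ((N : ℝ) + 1) ^ (4 * γ'))) → let ρb := fun (N : ℕ) (z : Literature.Analysis.FluidPDE.Config (N + 1) (Fin 3) (UnitAddTorus (Fin 3))) (x : (UnitAddTorus (Fin 3))) => Literature.MathematicalPhysics.KineticTheory.empiricalDensityField z (fun y => φ N (y - x)); let mb := fun (N : ℕ) (z : Literature.Analysis.FluidPDE.Config (N + 1) (Fin 3) (UnitAddTorus (Fin 3))) (x : (UnitAddTorus (Fin 3))) => Literature.MathematicalPhysics.KineticTheory.empiricalMomentumField z (fun y => φ N (y - x)); let ub := fun (N : ℕ) (z : Literature.Analysis.FluidPDE.Config (N + 1) (Fin 3) (UnitAddTorus (Fin 3))) (x : (UnitAddTorus (Fin 3))) => (ρb N z x)⁻¹ • mb N z x; let D := fun (N : ℕ) (z : Literature.Analysis.FluidPDE.Config (N + 1) (Fin 3) (UnitAddTorus (Fin 3))) (x : (UnitAddTorus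 (Fin 3))) (j k : Fin 3) => (∫ y, φ N (y.1 - x) * ((y.2 j - ub N z x j) * (y.2 k - ub N z x k)) ∂(Literature.Analysis.FluidPDE.empiricalMeasure z)) - (if j = k then (∑ l : Fin 3, ∫ y, φ N (y.1 - x) * (y.2 l - ub N z x l) ^ 2 ∂(Literature.Analysis.FluidPDE.empiricalMeasure z)) / 3 else 0); let q := fun (N : ℕ) (z : Literature.Analysis.FluidPDE.Config (N + 1) (Fin 3) (UnitAddTorus (Fin 3))) (x : (UnitAddTorus (Fin 3))) => ∫ y, (φ N (y.1 - x) * ‖y.2 - ub N z x‖ ^ 2 / 2) • (y.2 - ub N z x) ∂(Literature.Analysis.FluidPDE.empiricalMeasure z); let ρf := fun (N : ℕ) (z : Literature.Analysis.FluidPDE.Config (N + 1) (Fin 3) (UnitAddTorus (Fin 3))) (x : (UnitAddTorus (Fin 3))) => Literature.MathematicalPhysics.KineticTheory.empiricalDensityField z (fun y => φ' N (y - x)); let mf := fun (N : ℕ) (z : Literature.Analysis.FluidPDE.Config (N + 1) (Fin 3) (UnitAddTorus (Fin 3))) (x : (UnitAddTorus (Fin 3))) => Literature.MathematicalPhysics.KineticTheory.empiricalMomentumField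 z (fun y => φ' N (y - x)); let uf := fun (N : ℕ) (z : Literature.Analysis.FluidPDE.Config (N + 1) (Fin 3) (UnitAddTorus (Fin 3))) (x : (UnitAddTorus (Fin 3))) => (ρf N z x)⁻¹ • mf N z x; ∀ t : ℝ, 0 < t → ∀ δ : ℝ, 0 < δ → Tendsto (fun N : ℕ => Literature.MathematicalPhysics.KineticTheory.localGibbsLaw σ a₀ u₀ θ₀ N (Φ N) {z | δ < ∫ s in Icc 0 t, ∫ x, (∫ y : UnitAddTorus (Fin 3), φ N (y - x) * (ρf N ((Φ N).flow s z) y * ‖uf N ((Φ N).flow s z) y - ub N ((Φ N).flow s z) x‖ ^ 2)) ^ 2}) atTop (𝓝 0)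

/-- **Glue 2 (the Germano lift):** sub-viscous relaxation + no mesoscale cascade + the speed cap (for
the cubic subgrid terms of the heat flux and the kernel commutators) give the crux at its own scales. -/
def LiftGlue : Prop :=
  FastMomentRelaxationSubViscous → NoMesoCascadeL2 → MaxSpeedBoundAllTimes →
    Summit.AtomisticToContinuum.HydrodynamicLimit.Theses.StiffCollisionalRelaxation.FastMomentRelaxation

/-! ## Card 2 — blind contact chaos + free balance + measure rigidity -/

open Literature.MathematicalPhysics.KineticTheory in
/-- **Weighted balance rigidity (first lemma of card 2).** A finite measure on `ℝ³` with finite second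
moment whose contact statistics, weighted by ANY collision-symmetric, `ω`-even, two-sided bounded weight
`G(v,w,ω) = G(v',w',ω) = G(v,w,-ω)`, are collisionally balanced for all bounded continuous tests, is a point mass or
a Maxwellian. `G ≡ 1` is `LimitCollisionMeasure.BalanceRigidity` (stmt-13355; in print through
Lu–Mouhot 2015 Thm 5); velocity-blind `G = λ` and deflection-angle weights `G = b(|ĝ·ω|)` are covered
by the same theorem; general `G` is the formal H-theorem computation with `p = log f`. -/
def WeightedBalanceRigidity : Prop :=
  ∀ m : Measure V3, IsFiniteMeasure m → Integrable (fun v => ‖v‖ ^ 2) m →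
    ∀ G : V3 × V3 → Metric.sphere (0 : V3) 1 → ℝ,
      Measurable (fun p : (V3 × V3) × Metric.sphere (0 : V3) 1 => G p.1 p.2) →
      (∃ c C : ℝ, 0 < c ∧ ∀ p ω, c ≤ G p ω ∧ G p ω ≤ C) →
      (∀ p ω, G (collide ω p) ω = G p ω) → (∀ p ω, G p (-ω) = G p ω) →
      (∀ φ : V3 → ℝ, Continuous φ → (∃ B : ℝ, ∀ v, |φ v| ≤ B) →
        ∫ v, ∫ w, ∫ ω : Metric.sphere (0 : V3) 1,
            hardSphereKernel (v, w) ω * G (v, w) ω *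
              (φ (collide ω (v, w)).1 + φ (collide ω (v, w)).2 - φ v - φ w) ∂sphereMeasure ∂m ∂m = 0) →
      (∃ c : ℝ≥0∞, ∃ u : V3, m = c • Measure.dirac u) ∨
        (∃ ρ θ : ℝ, ∃ u : V3, 0 < ρ ∧ 0 < θ ∧
          m = volume.withDensity (fun v => ENNReal.ofReal (Literature.Analysis.FluidPDE.localMaxwellian ρ θ u v)))

/-- **Typed transfer of card 2 (over existing items only):** the crux is a corollary of the
LimitCollisionMeasure items ContactChaos (stmt-13350; only its velocity-BLIND content is used),
CollisionTightness (13354), EmpiricalEnskogIdentity (13356, provable now), BalanceRigidity (13355) and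
the speed cap (L² upgrade of "local law Maxwellian a.e."). -/
def BlindContactDock : Prop :=
  Summit.AtomisticToContinuum.HydrodynamicLimit.Theses.LimitCollisionMeasure.ContactChaos →
    Summit.AtomisticToContinuum.HydrodynamicLimit.Theses.LimitCollisionMeasure.CollisionTightness →
      Summit.AtomisticToContinuum.HydrodynamicLimit.Theses.LimitCollisionMeasure.EmpiricalEnskogIdentity →
        Summit.AtomisticToContinuum.HydrodynamicLimit.Theses.LimitCollisionMeasure.BalanceRigidity →
          MaxSpeedBoundAllTimes →
            Summit.AtomisticToContinuum.HydrodynamicLimit.Theses.StiffCollisionalRelaxation.FastMomentRelaxation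

/-- Sanity: the weighted rigidity with `G ≡ 1` gives back the route's `BalanceRigidity` (pure logic). -/
theorem balanceRigidity_of_weighted (h : WeightedBalanceRigidity) :
    Summit.AtomisticToContinuum.HydrodynamicLimit.Theses.LimitCollisionMeasure.BalanceRigidity := by
  intro m hfin hint hbal
  refine h m hfin hint (fun _ _ => 1) measurable_const ⟨1, 1, one_pos, fun _ _ => ⟨le_rfl, le_rfl⟩⟩
    (fun _ _ => rfl) (fun _ _ => rfl) ?_
  intro φ hφ hB
  simpa using hbal φ hφ hB

end Summit.AtomisticToContinuum.HydrodynamicLimit.Cruxes.FastMomentRelaxation.IdeatorOne
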